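import Summits.AtomisticToContinuum.HydrodynamicLimit.Theorems.InformationPercolationEngineCollisionRateTubeRegular
import Literature.MathematicalPhysics.KineticTheory.CollisionTubePullbackRung0Reduction
import Literature.MathematicalPhysics.KineticTheory.CollisionTubePullbackPacking
import HarnessLib

/-!
# T2red: the collision-cylinder pull-back of the UNIT-mark collision statistic from its three residual
# concentrations, GENERAL local Gibbs profiles (`stub_cylinderPullbackUnit_of_residuals`, line `Sketch`,
# crux `InformationPercolationEngine.CollisionRate`, stmt-AtomisticToContinuum-13481)

The crux `CollisionRate` is the even collision statistic `evenStat σ N Φ τ χ g Ξ r` at the constant mark `Ξ ≡ 1`;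
its tube chassis runs on the SPEED-TRUNCATED unit mark `Ξ₁ᴸ(n̂, v, w) = ψ_L(‖w − v‖)` (`speedCutoff`; `|Ξ₁ᴸ| ≤ 1 ≤ 2L`,
continuous, `= 0` for relative speed `≥ 2L`).  The registered stub T2red proved here is the general-profile port of
the landed rung-0 assembly `cylinderPullbackUnitRung0_of_residuals`: given, under the EVOLVED local Gibbs law
`localGibbsLaw σ a₀ u₀ θ₀ N (Φ N)` of continuous positive profiles, in-probability smallness of
* the continuity correction `((N+1)κ)⁻¹ R_cont[Ψ]` for every mark `|Ψ| ≤ 2L` (`h1`, frame with `η₀, χ, g, r`),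
* the short-flight deficit `((N+1)κ)⁻¹ R_short[Ψ]` for every such mark (`h2`, frame without `χ, g, r`),
* the mark-free three-body collision sum `ε/(N+1) · N₃` (`h3`, same frame),
conclude `LG{|evenStat(Ξ₁ᴸ) − evenTubeTimeStat(Ξ₁ᴸ, κ)| > η} ≤ δ` for `κ < κ₀`, `N ≥ N₀`.

Proof (verbatim the rung-0 one with the constant profiles replaced by `a₀ u₀ θ₀`): on a good orbit the exact Enskog
slicing `evenStat_sub_evenTubeTimeStat_eq` (integrability by `integrableOn_tubeStat_enskogRate_orbit_of_regular` from
13078's tube statics `Theorems.measurable_tubeStat_uncurry` / `Theorems.exists_bound_tubeStat` and the mark-1 S6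
`evenTubeStatRegular_one`), Boltzmann's collision cylinder `cylinderPullback_pathwise`
(`Literature/…/CollisionTubePullbackPathwise`, generic in the mark), the deterministic late pairs `residual_latePairs`
(packing, already general-profile), sup constants of `χ` on `[0, τ] × 𝕋³` and of `g` on `[0, ∞)` by compactness, and a
union bound over four events off the null bad set `localGibbsLaw_goodCompl`.

References: C. Cercignani, R. Illner, M. Pulvirenti, *The Mathematical Theory of Dilute Gases* (1994), §2.2,
App. 4.A; I. Gallagher, L. Saint-Raymond, B. Texier, *From Newton to Boltzmann* (2013), Prop. 4.1.1.
-/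

noncomputable section

open MeasureTheory Set Filter Topology
open scoped ENNReal InnerProductSpace BigOperators

namespace Summit.AtomisticToContinuum.HydrodynamicLimit.Theorems.CollisionRate

open Literature.Analysis.FluidPDE Literature.MathematicalPhysics.KineticTheory

/-! ## The assembly at `Ξ₁ᴸ`, general profiles: residual concentrations ⇒ the registered pull-back -/

/-- Elementary: `x · η/(4(x+1)) ≤ η/4` for `x, η ≥ 0`. [folklore] -/
private theorem mul_eta_div_le_unit {x η : ℝ} (hx : 0 ≤ x) (hη : 0 ≤ η) :
    x * (η / (4 * (x + 1))) ≤ η / 4 := by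
  rw [show x * (η / (4 * (x + 1))) = η / 4 * (x / (x + 1)) by field_simp]
  exact mul_le_of_le_one_right (by positivity) ((div_le_one (by linarith)).2 (by linarith))

/-- **T2red · THE PULL-BACK FROM ITS RESIDUALS, GENERAL PROFILES** (registered stub
`stub_cylinderPullbackUnit_of_residuals` of the line `Sketch`, crux `InformationPercolationEngine.CollisionRate`,
stmt-AtomisticToContinuum-13481; general-profile port of the landed rung-0 assembly
`cylinderPullbackUnitRung0_of_residuals` and mark-`Ξ₁ᴸ` twin of the sibling's
`EvenStressEnskog.stub_cylinderPullbackOfResiduals`).  Given, under the evolved local Gibbs law of continuous positive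
profiles, the in-probability smallness of the continuity correction (`h1`) and of the short-flight deficit (`h2`) for
every mark bounded by `2L`, and of the mark-free three-body collision sum (`h3`), the speed-truncated unit-mark
collision statistic `evenStat(Ξ₁ᴸ)` is within `η` of the time-integrated tube statistic `evenTubeTimeStat(Ξ₁ᴸ, κ)`
outside an event of probability `≤ δ`, for `κ < κ₀` and `N ≥ N₀`: on a good orbit the two differ from
`collisionSum − tubeTimeStat … 1 κ` by nothing (exact Enskog slicing `evenStat_sub_evenTubeTimeStat_eq`, integrability
by `integrableOn_tubeStat_enskogRate_orbit_of_regular` from the mark-1 S6 `evenTubeStatRegular_one` and 13078's tube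
statics), the latter is bounded by the pathwise pull-back `cylinderPullback_pathwise` (`|Ξ₁ᴸ| ≤ 1 ≤ 2L`, continuous,
`= 0` for relative speed `≥ 2L`), the late pairs are `O(ε)` (`residual_latePairs`), and a union bound off the null
bad set (`localGibbsLaw_goodCompl`) concludes. [folklore] -/
theorem stub_cylinderPullbackUnit_of_residuals :
    (∃ η₀ : ℝ, 0 < η₀ ∧ ∀ (a₀ θ₀ : T3 → ℝ) (u₀ : T3 → V3), Continuous a₀ → Continuous θ₀ → Continuous u₀ →
      (∀ x, 0 < a₀ x) → (∀ x, 0 < θ₀ x) → ∃ σ₀ : ℝ, 0 < σ₀ ∧ ∀ σ : ℝ, 0 < σ → σ < σ₀ →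
      ∀ Φ : (N : ℕ) → HardSphereFlow (Torus.geometry (Fin 3)) (hsDiameter σ N) (N + 1),
      ∀ τ : ℝ, 0 < τ → ∀ χ : ℝ × T3 → ℝ, Continuous χ → ∀ g : ℝ → ℝ, Continuous g →
      (∀ x, η₀ ≤ x → g x = 0) →
      ∀ η δ : ℝ, 0 < η → 0 < δ → ∃ r₀ : ℝ, 0 < r₀ ∧ ∀ r : ℝ, 0 < r → r < r₀ →
      ∀ L : ℝ, 1 ≤ L → ∃ κ₀ : ℝ, 0 < κ₀ ∧ ∀ κ : ℝ, 0 < κ → κ < κ₀ → ∃ N₀ : ℕ, ∀ N : ℕ, N₀ ≤ N →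
      ∀ Ψ : V3 × V3 × V3 → ℝ, (∀ q, |Ψ q| ≤ 2 * L) →
        localGibbsLaw σ a₀ u₀ θ₀ N (Φ N)
          {z | η < ((N + 1 : ℝ) * κ)⁻¹ * continuityCorrection σ N (Φ N) τ χ g Ψ r κ z} ≤ ENNReal.ofReal δ) →
    (∀ (a₀ θ₀ : T3 → ℝ) (u₀ : T3 → V3), Continuous a₀ → Continuous θ₀ → Continuous u₀ →
      (∀ x, 0 < a₀ x) → (∀ x, 0 < θ₀ x) → ∃ σ₀ : ℝ, 0 < σ₀ ∧ ∀ σ : ℝ, 0 < σ → σ < σ₀ →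
      ∀ Φ : (N : ℕ) → HardSphereFlow (Torus.geometry (Fin 3)) (hsDiameter σ N) (N + 1),
      ∀ τ : ℝ, 0 < τ → ∀ η δ : ℝ, 0 < η → 0 < δ →
      ∀ L : ℝ, 1 ≤ L → ∃ κ₀ : ℝ, 0 < κ₀ ∧ ∀ κ : ℝ, 0 < κ → κ < κ₀ → ∃ N₀ : ℕ, ∀ N : ℕ, N₀ ≤ N →
      ∀ Ψ : V3 × V3 × V3 → ℝ, (∀ q, |Ψ q| ≤ 2 * L) →
        localGibbsLaw σ a₀ u₀ θ₀ N (Φ N)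
          {z | η < ((N + 1 : ℝ) * κ)⁻¹ * shortFlightDeficit σ N (Φ N) τ Ψ κ z} ≤ ENNReal.ofReal δ) →
    (∀ (a₀ θ₀ : T3 → ℝ) (u₀ : T3 → V3), Continuous a₀ → Continuous θ₀ → Continuous u₀ →
      (∀ x, 0 < a₀ x) → (∀ x, 0 < θ₀ x) → ∃ σ₀ : ℝ, 0 < σ₀ ∧ ∀ σ : ℝ, 0 < σ → σ < σ₀ →
      ∀ Φ : (N : ℕ) → HardSphereFlow (Torus.geometry (Fin 3)) (hsDiameter σ N) (N + 1),
      ∀ τ : ℝ, 0 < τ → ∀ η δ : ℝ, 0 < η → 0 < δ →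
      ∀ L : ℝ, 1 ≤ L → ∃ κ₀ : ℝ, 0 < κ₀ ∧ ∀ κ : ℝ, 0 < κ → κ < κ₀ → ∃ N₀ : ℕ, ∀ N : ℕ, N₀ ≤ N →
        localGibbsLaw σ a₀ u₀ θ₀ N (Φ N)
          {z | η < hsDiameter σ N / (N + 1 : ℝ) * threeBodyCollisionSum σ N (Φ N) τ L κ z} ≤ ENNReal.ofReal δ) →
    ∃ η₀ : ℝ, 0 < η₀ ∧ ∀ (a₀ θ₀ : T3 → ℝ) (u₀ : T3 → V3), Continuous a₀ → Continuous θ₀ → Continuous u₀ →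
      (∀ x, 0 < a₀ x) → (∀ x, 0 < θ₀ x) → ∃ σ₀ : ℝ, 0 < σ₀ ∧ ∀ σ : ℝ, 0 < σ → σ < σ₀ →
      ∀ Φ : (N : ℕ) → HardSphereFlow (Torus.geometry (Fin 3)) (hsDiameter σ N) (N + 1),
      ∀ τ : ℝ, 0 < τ → ∀ χ : ℝ × T3 → ℝ, Continuous χ → ∀ g : ℝ → ℝ, Continuous g →
      (∀ x, η₀ ≤ x → g x = 0) →
      ∀ η δ : ℝ, 0 < η → 0 < δ → ∃ r₀ : ℝ, 0 < r₀ ∧ ∀ r : ℝ, 0 < r → r < r₀ →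
      ∀ L : ℝ, 1 ≤ L → ∃ κ₀ : ℝ, 0 < κ₀ ∧ ∀ κ : ℝ, 0 < κ → κ < κ₀ → ∃ N₀ : ℕ, ∀ N : ℕ, N₀ ≤ N →
        localGibbsLaw σ a₀ u₀ θ₀ N (Φ N)
          {z | η < |evenStat σ N (Φ N) τ χ g (fun q : V3 × V3 × V3 => speedCutoff L ‖q.2.2 - q.2.1‖) r z -
              evenTubeTimeStat σ N (Φ N) τ χ g (fun q : V3 × V3 × V3 => speedCutoff L ‖q.2.2 - q.2.1‖) r κ z|}
          ≤ ENNReal.ofReal δ := by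
  -- adapted from `cylinderPullbackUnitRung0_of_residuals` (rung 0) and the sibling's
  -- `EvenStressEnskog.stub_cylinderPullbackOfResiduals` (general frame)
  intro h1 h2 h3
  obtain ⟨η₆, hη₆, H6⟩ := evenTubeStatRegular_one
  obtain ⟨η₁, hη₁, H1⟩ := h1
  refine ⟨min η₁ η₆, lt_min hη₁ hη₆, ?_⟩
  intro a₀ θ₀ u₀ ha hθ hu ha0 hθ0
  obtain ⟨σ₁, hσ₁, H1⟩ := H1 a₀ θ₀ u₀ ha hθ hu ha0 hθ0
  obtain ⟨σ₂, hσ₂, H2⟩ := h2 a₀ θ₀ u₀ ha hθ hu ha0 hθ0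
  obtain ⟨σ₃, hσ₃, H3⟩ := h3 a₀ θ₀ u₀ ha hθ hu ha0 hθ0
  obtain ⟨σ₄, hσ₄, H4⟩ := residual_latePairs a₀ θ₀ u₀ ha hθ hu ha0 hθ0
  refine ⟨min (min (min σ₁ σ₂) (min σ₃ σ₄)) (1 / 4),
    lt_min (lt_min (lt_min hσ₁ hσ₂) (lt_min hσ₃ hσ₄)) (by norm_num), ?_⟩
  intro σ hσ hσlt Φ τ hτ χ hχ g hg hg0 η δ hη hδ
  have hσ' : σ < min (min σ₁ σ₂) (min σ₃ σ₄) := lt_of_lt_of_le hσlt (min_le_left _ _)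
  have hσ₁' : σ < σ₁ := lt_of_lt_of_le hσ' ((min_le_left _ _).trans (min_le_left _ _))
  have hσ₂' : σ < σ₂ := lt_of_lt_of_le hσ' ((min_le_left _ _).trans (min_le_right _ _))
  have hσ₃' : σ < σ₃ := lt_of_lt_of_le hσ' ((min_le_right _ _).trans (min_le_left _ _))
  have hσ₄' : σ < σ₄ := lt_of_lt_of_le hσ' ((min_le_right _ _).trans (min_le_right _ _))
  have hg1 : ∀ a, η₁ ≤ a → g a = 0 := fun a h => hg0 a ((min_le_left _ _).trans h)
  have hg6 : ∀ a, η₆ ≤ a → g a = 0 := fun a h => hg0 a ((min_le_right _ _).trans h)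
  -- sup constants of `χ` on `[0, τ] × 𝕋³` and of `g` on `[0, ∞)`
  obtain ⟨Cχ, hCχ⟩ := (isCompact_Icc.prod isCompact_univ :
    IsCompact (Icc (0 : ℝ) τ ×ˢ (univ : Set (UnitAddTorus (Fin 3))))).exists_bound_of_continuousOn hχ.continuousOn
  have hχb : ∀ t ∈ Icc (0 : ℝ) τ, ∀ x, |χ (t, x)| ≤ Cχ := fun t ht x => by
    simpa only [Real.norm_eq_abs] using hCχ (t, x) ⟨ht, mem_univ _⟩
  obtain ⟨Cg, hCg⟩ := (isCompact_Icc (a := (0 : ℝ)) (b := min η₁ η₆)).exists_bound_of_continuousOn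
    hg.continuousOn
  have hCg0 : 0 ≤ Cg := (norm_nonneg _).trans (hCg 0 ⟨le_rfl, (lt_min hη₁ hη₆).le⟩)
  have hgb : ∀ a, 0 ≤ a → |g a| ≤ Cg := by
    intro a ha0'
    rcases le_or_gt a (min η₁ η₆) with hle | hlt
    · simpa only [Real.norm_eq_abs] using hCg a ⟨ha0', hle⟩
    · rw [hg0 a hlt.le, abs_zero]; exact hCg0
  have hCχ0 : 0 ≤ Cχ := (abs_nonneg _).trans (hχb 0 ⟨le_rfl, hτ.le⟩ 0)
  have hCC : 0 ≤ Cχ * Cg := mul_nonneg hCχ0 hCg0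
  -- accuracies (those of `h2`, `h3`, `h4` are chosen after `L`)
  have hη4 : 0 < η / 4 := by positivity
  have hδ4 : 0 < δ / 4 := by positivity
  have hη2 : 0 < η / (4 * (Cχ * Cg + 1)) := by positivity
  obtain ⟨r₁, hr₁, H1⟩ := H1 σ hσ hσ₁' Φ τ hτ χ hχ g hg hg1 (η / 4) (δ / 4) hη4 hδ4
  refine ⟨r₁, hr₁, ?_⟩
  intro r hr hr1 L hL
  have hL0 : 0 < L := one_pos.trans_le hL
  have hη3 : 0 < η / (4 * (2 * (Cχ * Cg * (2 * L)) + 1)) := by positivity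
  have hη4' : 0 < η / (4 * (Cχ * Cg * (2 * L) + 1)) := by positivity
  obtain ⟨κ₁, hκ₁, H1⟩ := H1 r hr hr1 L hL
  obtain ⟨κ₂, hκ₂, H2⟩ := H2 σ hσ hσ₂' Φ τ hτ (η / (4 * (Cχ * Cg + 1))) (δ / 4) hη2 hδ4 L hL
  obtain ⟨κ₃, hκ₃, H3⟩ := H3 σ hσ hσ₃' Φ τ hτ (η / (4 * (2 * (Cχ * Cg * (2 * L)) + 1))) (δ / 4) hη3 hδ4 L hL
  obtain ⟨κ₄, hκ₄, H4⟩ := H4 σ hσ hσ₄' Φ τ hτ (η / (4 * (Cχ * Cg * (2 * L) + 1))) (δ / 4) hη4' hδ4 L hL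
  refine ⟨min (min (min κ₁ κ₂) (min κ₃ κ₄)) (1 / (4 * L)),
    lt_min (lt_min (lt_min hκ₁ hκ₂) (lt_min hκ₃ hκ₄)) (by positivity), ?_⟩
  intro κ hκ hκlt
  have hκ' : κ < min (min κ₁ κ₂) (min κ₃ κ₄) := lt_of_lt_of_le hκlt (min_le_left _ _)
  have hκL : κ < 1 / (4 * L) := lt_of_lt_of_le hκlt (min_le_right _ _)
  have hκ₁' : κ < κ₁ := lt_of_lt_of_le hκ' ((min_le_left _ _).trans (min_le_left _ _))
  have hκ₂' : κ < κ₂ := lt_of_lt_of_le hκ' ((min_le_left _ _).trans (min_le_right _ _))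
  have hκ₃' : κ < κ₃ := lt_of_lt_of_le hκ' ((min_le_right _ _).trans (min_le_left _ _))
  have hκ₄' : κ < κ₄ := lt_of_lt_of_le hκ' ((min_le_right _ _).trans (min_le_right _ _))
  obtain ⟨N₁, H1⟩ := H1 κ hκ hκ₁'
  obtain ⟨N₂, H2⟩ := H2 κ hκ hκ₂'
  obtain ⟨N₃, H3⟩ := H3 κ hκ hκ₃'
  obtain ⟨N₄, H4⟩ := H4 κ hκ hκ₄'
  refine ⟨max (max N₁ N₂) (max N₃ N₄), fun N hN => ?_⟩
  have hN1 : N₁ ≤ N := ((le_max_left _ _).trans (le_max_left _ _)).trans hN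
  have hN2 : N₂ ≤ N := ((le_max_right _ _).trans (le_max_left _ _)).trans hN
  have hN3 : N₃ ≤ N := ((le_max_left _ _).trans (le_max_right _ _)).trans hN
  have hN4 : N₄ ≤ N := ((le_max_right _ _).trans (le_max_right _ _)).trans hN
  -- the mark `Ξ₁ᴸ`: continuous, `|Ξ₁ᴸ| ≤ 1 ≤ 2L`, `= 0` for relative speed `≥ 2L`
  set Ξ : V3 × V3 × V3 → ℝ := fun q => speedCutoff L ‖q.2.2 - q.2.1‖ with hΞ
  have hΨc : Continuous Ξ := continuous_speedCutoff_mark L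
  have hΨb : ∀ p, |Ξ p| ≤ 2 * L := fun p => (abs_speedCutoff_le_one L _).trans (by linarith)
  have hΨ0 : ∀ n v w : V3, 2 * L ≤ ‖w - v‖ → Ξ (n, v, w) = 0 := fun n v w h => speedCutoff_eq_zero hL0 h
  -- regularity of `A_t` and `W_t` at `Ξ₁ᴸ` (13078's tube statics and the mark-1 S6)
  have hA := Theorems.measurable_tubeStat_uncurry σ N hχ hg hΨc r r 1 κ
  obtain ⟨BA, hBA⟩ := Theorems.exists_bound_tubeStat σ N hχ hg (exists_abs_speedCutoff_mark_le L) hr r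
    zero_le_one hκ.le τ
  obtain ⟨hW, BW, hBW⟩ := H6 σ N χ g L r κ τ hσ hχ hg hg6 hL0 hr hκ.le
  have E1 := H1 N hN1 Ξ hΨb
  have E2 := H2 N hN2 Ξ hΨb
  have E3 := H3 N hN3
  have E4 := H4 N hN4
  -- the minimal-image smallness `ε (1 + 2 L κ) < 1/2`
  have hLκ : 2 * L * κ ≤ 1 / 2 := by
    have : L * κ ≤ L * (1 / (4 * L)) := mul_le_mul_of_nonneg_left hκL.le hL0.le
    rw [show L * (1 / (4 * L)) = 1 / 4 by field_simp] at this
    linarith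
  have hsmall : hsDiameter σ N * (1 + 2 * L * κ) < 1 / 2 := by
    have hε := hsDiameter_le hσ.le N
    have hε0 := (hsDiameter_pos hσ N).le
    have hσ4 : σ < 1 / 4 := lt_of_lt_of_le hσlt (min_le_right _ _)
    nlinarith
  -- the union bound on the good set
  set P := localGibbsLaw σ a₀ u₀ θ₀ N (Φ N) with hP
  set S₁ := {z : Config (N + 1) (Fin 3) T3 | η / 4 <
    ((N + 1 : ℝ) * κ)⁻¹ * continuityCorrection σ N (Φ N) τ χ g Ξ r κ z} with hS₁
  set S₂ := {z : Config (N + 1) (Fin 3) T3 | η / (4 * (Cχ * Cg + 1)) <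
    ((N + 1 : ℝ) * κ)⁻¹ * shortFlightDeficit σ N (Φ N) τ Ξ κ z} with hS₂
  set S₃ := {z : Config (N + 1) (Fin 3) T3 | η / (4 * (2 * (Cχ * Cg * (2 * L)) + 1)) <
    hsDiameter σ N / (N + 1 : ℝ) * threeBodyCollisionSum σ N (Φ N) τ L κ z} with hS₃
  set S₄ := {z : Config (N + 1) (Fin 3) T3 | η / (4 * (Cχ * Cg * (2 * L) + 1)) <
    hsDiameter σ N / (N + 1 : ℝ) * pairShellCount σ N L κ ((Φ N).flow τ z)} with hS₄
  set E := {z : Config (N + 1) (Fin 3) T3 | η <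
    |evenStat σ N (Φ N) τ χ g Ξ r z - evenTubeTimeStat σ N (Φ N) τ χ g Ξ r κ z|} with hE
  have hsub : E ∩ (Φ N).good ⊆ ((S₁ ∪ S₂) ∪ S₃) ∪ S₄ := by
    rintro z ⟨hz, hgood⟩
    obtain ⟨hIA, hIe⟩ := integrableOn_tubeStat_enskogRate_orbit_of_regular hgood hσ hA hBA hW hBW
    rw [hE, Set.mem_setOf_eq, evenStat_sub_evenTubeTimeStat_eq (Φ := Φ N) z hIA hIe] at hz
    by_contra hnot
    simp only [Set.mem_union, not_or, hS₁, hS₂, hS₃, hS₄, Set.mem_setOf_eq, not_lt] at hnot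
    obtain ⟨⟨⟨b1, b2⟩, b3⟩, b4⟩ := hnot
    have hpath := cylinderPullback_pathwise σ N (Φ N) τ χ g Ξ r r κ L Cχ Cg (2 * L) z
      hgood hσ hτ hr hκ hL0.le hsmall hχ hg hΨc hχb hgb hΨb hΨ0
    have hc : 0 ≤ ((N + 1 : ℝ) * κ)⁻¹ := by positivity
    have hεN : 0 ≤ hsDiameter σ N / (N + 1 : ℝ) := by
      have := (hsDiameter_pos hσ N).le; positivity
    have t2 : ((N + 1 : ℝ) * κ)⁻¹ * (Cχ * Cg * shortFlightDeficit σ N (Φ N) τ Ξ κ z) ≤ η / 4 := by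
      calc ((N + 1 : ℝ) * κ)⁻¹ * (Cχ * Cg * shortFlightDeficit σ N (Φ N) τ Ξ κ z)
          = Cχ * Cg * (((N + 1 : ℝ) * κ)⁻¹ * shortFlightDeficit σ N (Φ N) τ Ξ κ z) := by ring
        _ ≤ Cχ * Cg * (η / (4 * (Cχ * Cg + 1))) := mul_le_mul_of_nonneg_left b2 hCC
        _ ≤ η / 4 := mul_eta_div_le_unit hCC hη.le
    have t3 : Cχ * Cg * (2 * L) * (hsDiameter σ N / (N + 1 : ℝ)) *
        (2 * threeBodyCollisionSum σ N (Φ N) τ L κ z) ≤ η / 4 := by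
      calc Cχ * Cg * (2 * L) * (hsDiameter σ N / (N + 1 : ℝ)) * (2 * threeBodyCollisionSum σ N (Φ N) τ L κ z)
          = 2 * (Cχ * Cg * (2 * L)) *
              (hsDiameter σ N / (N + 1 : ℝ) * threeBodyCollisionSum σ N (Φ N) τ L κ z) := by ring
        _ ≤ 2 * (Cχ * Cg * (2 * L)) * (η / (4 * (2 * (Cχ * Cg * (2 * L)) + 1))) :=
            mul_le_mul_of_nonneg_left b3 (by positivity)
        _ ≤ η / 4 := mul_eta_div_le_unit (by positivity) hη.le
    have t4 : Cχ * Cg * (2 * L) * (hsDiameter σ N / (N + 1 : ℝ)) * pairShellCount σ N L κ ((Φ N).flow τ z) ≤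
        η / 4 := by
      calc Cχ * Cg * (2 * L) * (hsDiameter σ N / (N + 1 : ℝ)) * pairShellCount σ N L κ ((Φ N).flow τ z)
          = Cχ * Cg * (2 * L) * (hsDiameter σ N / (N + 1 : ℝ) * pairShellCount σ N L κ ((Φ N).flow τ z)) := by
            ring
        _ ≤ Cχ * Cg * (2 * L) * (η / (4 * (Cχ * Cg * (2 * L) + 1))) :=
            mul_le_mul_of_nonneg_left b4 (by positivity)
        _ ≤ η / 4 := mul_eta_div_le_unit (by positivity) hη.le
    have hle : |collisionSum σ N (Φ N) τ χ g Ξ r z - tubeTimeStat σ N (Φ N) τ χ g Ξ r r 1 κ z| ≤ η := by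
      refine hpath.trans ?_
      rw [mul_add, mul_add]
      linarith
    exact (not_lt.2 hle) hz
  have hgoodc : P (Φ N).goodᶜ = 0 := localGibbsLaw_goodCompl (Φ N)
  calc P E = P (E ∩ (Φ N).good ∪ E \ (Φ N).good) := by rw [Set.inter_union_sdiff]
    _ ≤ P (E ∩ (Φ N).good) + P (E \ (Φ N).good) := measure_union_le _ _
    _ ≤ P (((S₁ ∪ S₂) ∪ S₃) ∪ S₄) + 0 := by
        refine add_le_add (measure_mono hsub) ?_
        exact (measure_mono fun z hz => hz.2).trans hgoodc.le
    _ ≤ P S₁ + P S₂ + P S₃ + P S₄ := by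
        rw [add_zero]
        exact (measure_union_le _ _).trans (add_le_add ((measure_union_le _ _).trans
          (add_le_add (measure_union_le _ _) le_rfl)) le_rfl)
    _ ≤ ENNReal.ofReal (δ / 4) + ENNReal.ofReal (δ / 4) + ENNReal.ofReal (δ / 4) + ENNReal.ofReal (δ / 4) :=
        add_le_add (add_le_add (add_le_add E1 E2) E3) E4
    _ = ENNReal.ofReal δ := by
        rw [← ENNReal.ofReal_add hδ4.le hδ4.le, ← ENNReal.ofReal_add (by positivity) hδ4.le,
          ← ENNReal.ofReal_add (by positivity) hδ4.le]
        congr 1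
        ring

end Summit.AtomisticToContinuum.HydrodynamicLimit.Theorems.CollisionRate

end
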